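import Summits.QuantumFields.YangMills.Theorems.UnitScaleTiltProp7CovIterLambdaHLambda
import Summits.QuantumFields.YangMills.Theorems.UnitScaleTiltProp7CovIterLambdaHLambdaBridge
import HarnessLib

/-!
# Route `UnitScaleTilt`, crux K1 «MinimiserStabilityRegPr» (stmt-QuantumFields-19200), route-R [RP] at a curved background — THE CURVED N6, ROW (R-B) ⟶ THE S2′ KNIT:
# the `hΛ` row in the knit's letters, `G₀` bounded by the curl, divergence and mass forms of the `B9Eq39Adjoint` calculus

Cell `ym3-torus`, D-0154 (3c) R3 twin-width seat `ym-routeR-w2` (W-SEAT MAP pass #3 row M9 «(R-B) instantiation + supplier junction»).  THEOREMS ONLY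
(0 `def`, 0 `sorry`); `--supports stmt-QuantumFields-19200`, count-neutral.  YM₃ on T³ is a ladder rung (R3), not the Clay problem; nothing here claims S2,
P, the crux or the gap.

WHERE THIS SITS.  ✓ `Prop7CovIterLambdaHLambda.sum_normSq_covIterLambda_le_T3` (this seat) bounds `Σ_y‖Λ_k y‖²` by `[25N·L⁴·E + 2700(3N+6)L⁶·E′]·L^k/(√L−1)²`
with `E = (√Σ‖∇^{U₀}Y‖² + C₁εL²L^{−k}√Σ‖Y‖²)²` in the OPERATOR-norm covariant gradient `∇^{U₀}Y(b,ν) = U₀(b.src,ν)Y(b+ν)U₀(b.src,ν)* − Y(b)`.  The S2′ knit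
(`Prop7CurvedLandauCoercivity.sum_normSq_le_curl_sq_of_landau_of_structure_T3`, ✓ p601741, and its tower form being typed by ★routeR-w3) displays
`hΛ : Σ_y‖Λ (K−n) y‖² ≤ cΛ·L^{K−n}·G₀` and spends `384·cΛ·G₀` against `18·Σ‖D_{U₀}Y‖²_HS` and `L^{−2(K−n)}Σ‖Y‖²`.  THIS FILE supplies that row with
`cΛ = 1` and `G₀` in the knit's letters (ingredients in part 1/2, `Prop7CovIterLambdaHLambdaBridge`: the op-norm Weitzenböck conversion
`sum_normSq_covGrad_le_curl_divB` and the scalar bookkeeping `rows_rhs_le`):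
* ★★★ `sum_normSq_covIterLambda_le_curl_T3` — for `F : T3Family`, `k = K − n`, an `SU(N)` background with the NON-strict (14)-type bound
  `dist1(U₀(∂p)) ≤ ε·(L^{2(K−n)})⁻¹` of ✓ p601741, `2·10⁵·L⁵·ε ≤ 1`, `300·N·L²·ε ≤ 1`, and the families `G`, `S`, `Λ` of the curved structure theorem
  (recursions displayed VERBATIM as in ✓ p616747 ∕ `Prop7CurvedLandauRowA`):
  `Σ_y ‖Λ (K−n) y‖² ≤ L^{K−n}·(100·N·L⁴·(CURL_HS + DIV_HS) + 10⁹·N²·L⁹·ε·(L^{2(K−n)})⁻¹·Σ_b‖Y b‖²)`;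
* ★ `sum_normSq_covIterLambda_le_curl_T3_su2` — the same at `SU(2)` under the knit's single numeral `10⁶·L⁵·ε ≤ 1`, concluded in the knit's exact shape
  `≤ 1 * L^{K−n} * G₀` (★routeR-w3's `Prop7CurvedLandauKnitT3.sum_normSq_le_curl_sq_of_divBudget_of_tower_T3` binder `hΛ`, `cΛ := 1`, by `exact`).
HONEST SCOPE.  Bookkeeping over landed theorems (this seat's (R-B) chain, the seat-p1 Weitzenböck file, [B7] Prop. 2 smallness); the numerals are crude.

References: T. Bałaban, CMP 102 (1985) 277–309 [Balaban1985Variational] ((135) p.298, (14) p.280); CMP 99 (1985) 389–434 [Balaban1985BackgroundPropagators]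
((3.3)–(3.10) pp.390–392, Thm 3.11 p.416); CMP 95 (1984) 17–40 [Balaban1984PropagatorsI] ((1.18)–(1.20) pp.19–20).
-/

noncomputable section

open scoped BigOperators Matrix.Norms.L2Operator Matrix

namespace Summit.QuantumFields.YangMills.Theorems.Prop7CovIterLambdaHLambdaCurl

open Literature.MathematicalPhysics.QuantumFieldTheory.Balaban1983to89
open Finset T4Continuum BlockAveraging AveragingRT ExpMeanLog BlockAveragingEMLLinearised BlockAveragingEMLLinearisedBackground BlockAveragingEMLProp2
open B1RG242Torus
open B9Eq39Adjoint (curl divB)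
open B10Eq27TorusAxialLog (unitsField toUField)
open B9TorusCalculus (torusT)
open Summit.QuantumFields.YangMills.Theorems.Prop7CovIterLambdaHLambda (sum_normSq_covIterLambda_le_T3)
open Summit.QuantumFields.YangMills.Theorems.Prop7CovIterLambdaHLambdaBridge (sum_normSq_covGrad_le_curl_divB one_div_le_deltaSU rows_rhs_le)

variable {N : ℕ} [NeZero N]

/-! ## The `hΛ` row of the S2′ knit, `G₀` in curl ∕ divergence ∕ mass form -/

set_option maxHeartbeats 400000 in
/-- ★★★ **(R-B) IN THE KNIT'S LETTERS**: for a `T3Family` background `U₀ ∈ SU(N)` with `dist1(U₀(∂p)) ≤ ε·(L^{2(K−n)})⁻¹` (the NON-strict (14)-type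
bound of ✓ p601741), `2·10⁵·L⁵·ε ≤ 1`, `300·N·L²·ε ≤ 1`, and the reduced ∕ pure-`LINE` ∕ coarse-gauge families `G`, `S`, `Λ` of the curved structure
theorem (recursions displayed), the coarse gauge function at level `K − n` obeys
`Σ_y ‖Λ (K−n) y‖² ≤ L^{K−n}·(100·N·L⁴·(Σ_{x,μ<ν}‖(D_{U₀}Y)(p_{μν}(x))‖²_HS + Σ_x‖(D*_{U₀}Y)(x)‖²_HS) + 10⁹·N²·L⁹·ε·(L^{2(K−n)})⁻¹·Σ_b‖Y b‖²)`
— the `hΛ` row of `Prop7CurvedLandauCoercivity.sum_normSq_le_curl_sq_of_landau_of_structure_T3` with `cΛ = 1` and an explicit `G₀` (the tower of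
`Prop7CovIterLambdaHLambda.sum_normSq_covIterLambda_le_T3` run at `2ε`, its operator-norm gradient energy converted by §1).
[cite: Balaban1985Variational, (135) p.298; Balaban1985BackgroundPropagators, Thm 3.11 p.416; Balaban1984PropagatorsI, (1.18)-(1.20) pp.19-20] -/
theorem sum_normSq_covIterLambda_le_curl_T3 (F : T3ContinuumYM3Torus.T3Family) (n K : ℕ)
    (U₀ : GaugeField (F.P K) 0 (Matrix.specialUnitaryGroup (Fin N) ℂ)) {ε : ℝ} (hε : 0 < ε)
    (hεL : 2 * 10 ^ 5 * (F.L : ℝ) ^ 5 * ε ≤ 1) (hεN : 300 * N * (F.L : ℝ) ^ 2 * ε ≤ 1)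
    (hU : ∀ p : Plaq (F.P K) 0, dist1 (GaugeField.plaqHol U₀ p) ≤ ε * (((F.L : ℝ) ^ (K - n)) ^ 2)⁻¹)
    (Y : PBond (F.P K) 0 → Matrix (Fin N) (Fin N) ℂ)
    (G S : (j : ℕ) → PBond (F.P K) j → Matrix (Fin N) (Fin N) ℂ) (Λ : (j : ℕ) → Site (F.P K) j → Matrix (Fin N) (Fin N) ℂ)
    (hΛ0 : ∀ y, Λ 0 y = 0) (hG0 : ∀ b, G 0 b = Y b) (hS0 : ∀ b, S 0 b = Y b)
    (hΛs : ∀ (j : ℕ) (z : Site (F.P K) (j + 1)), Λ (j + 1) z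
      = ((Fintype.card (Idx (F.P K)) : ℂ))⁻¹ • ∑ i : Idx (F.P K),
          covWalkSum (Averaging.iter (fun i => blockAvg (P := F.P K) (j := i) (expMeanLogSU (n := Fin N))) j U₀) (G j)
            (walk (emb z) (stairWord i.2.1 (off i.1)))
        + Λ j (emb z))
    (hGs : ∀ (k : ℕ) (c : PBond (F.P K) (k + 1)), G (k + 1) c
      = (fderiv ℂ (eml : (Idx (F.P K) → Matrix (Fin N) (Fin N) ℂ) → Matrix (Fin N) (Fin N) ℂ)
            (fun i => ((loopHol (Averaging.iter (fun i => blockAvg (P := F.P K) (j := i) (expMeanLogSU (n := Fin N))) k U₀) c i :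
              Matrix.specialUnitaryGroup (Fin N) ℂ) : Matrix (Fin N) (Fin N) ℂ))
            (fun i => covWalkSum (Averaging.iter (fun i => blockAvg (P := F.P K) (j := i) (expMeanLogSU (n := Fin N))) k U₀) (G k)
                (walk (emb c.src) (loopWord (F.P K).L c.dir (off i.1) i.2.1 i.2.2))
              * ((loopHol (Averaging.iter (fun i => blockAvg (P := F.P K) (j := i) (expMeanLogSU (n := Fin N))) k U₀) c i :
                Matrix.specialUnitaryGroup (Fin N) ℂ) : Matrix (Fin N) (Fin N) ℂ))
            * star ((corr (expMeanLogSU (n := Fin N)) (Averaging.iter (fun i => blockAvg (P := F.P K) (j := i) (expMeanLogSU (n := Fin N))) k U₀) c :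
                Matrix.specialUnitaryGroup (Fin N) ℂ) : Matrix (Fin N) (Fin N) ℂ)
          + ((corr (expMeanLogSU (n := Fin N)) (Averaging.iter (fun i => blockAvg (P := F.P K) (j := i) (expMeanLogSU (n := Fin N))) k U₀) c :
                Matrix.specialUnitaryGroup (Fin N) ℂ) : Matrix (Fin N) (Fin N) ℂ)
            * covWalkSum (Averaging.iter (fun i => blockAvg (P := F.P K) (j := i) (expMeanLogSU (n := Fin N))) k U₀) (G k)
                (walk (emb c.src) (List.replicate (F.P K).L (c.dir, true)))
            * star ((corr (expMeanLogSU (n := Fin N)) (Averaging.iter (fun i => blockAvg (P := F.P K) (j := i) (expMeanLogSU (n := Fin N))) k U₀) c :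
                Matrix.specialUnitaryGroup (Fin N) ℂ) : Matrix (Fin N) (Fin N) ℂ))
        - ((((Fintype.card (Idx (F.P K)) : ℂ))⁻¹ • ∑ i : Idx (F.P K),
              covWalkSum (Averaging.iter (fun i => blockAvg (P := F.P K) (j := i) (expMeanLogSU (n := Fin N))) k U₀) (G k) (walk (emb c.src) (stairWord i.2.1 (off i.1))))
            - ((Averaging.iter (fun i => blockAvg (P := F.P K) (j := i) (expMeanLogSU (n := Fin N))) (k + 1) U₀ c : Matrix.specialUnitaryGroup (Fin N) ℂ) :
                Matrix (Fin N) (Fin N) ℂ)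
              * (((Fintype.card (Idx (F.P K)) : ℂ))⁻¹ • ∑ i : Idx (F.P K),
                  covWalkSum (Averaging.iter (fun i => blockAvg (P := F.P K) (j := i) (expMeanLogSU (n := Fin N))) k U₀) (G k) (walk (emb c.tgt) (stairWord i.2.1 (off i.1))))
              * star ((Averaging.iter (fun i => blockAvg (P := F.P K) (j := i) (expMeanLogSU (n := Fin N))) (k + 1) U₀ c :
                Matrix.specialUnitaryGroup (Fin N) ℂ) : Matrix (Fin N) (Fin N) ℂ)))
    (hSs : ∀ (k : ℕ) (c : PBond (F.P K) (k + 1)), S (k + 1) c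
      = ((Fintype.card (Idx (F.P K)) : ℂ))⁻¹ • ∑ i : Idx (F.P K),
          ((holAt (Averaging.iter (fun i => blockAvg (P := F.P K) (j := i) (expMeanLogSU (n := Fin N))) k U₀) (walk (emb c.src) (stairWord i.2.1 (off i.1))) :
              Matrix.specialUnitaryGroup (Fin N) ℂ) : Matrix (Fin N) (Fin N) ℂ) *
            covWalkSum (Averaging.iter (fun i => blockAvg (P := F.P K) (j := i) (expMeanLogSU (n := Fin N))) k U₀) (S k)
              (walk (walkEnd (emb c.src) (stairWord i.2.1 (off i.1))) (List.replicate (F.P K).L (c.dir, true))) *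
          star ((holAt (Averaging.iter (fun i => blockAvg (P := F.P K) (j := i) (expMeanLogSU (n := Fin N))) k U₀) (walk (emb c.src) (stairWord i.2.1 (off i.1))) :
              Matrix.specialUnitaryGroup (Fin N) ℂ) : Matrix (Fin N) (Fin N) ℂ))
    :
    ∑ y : Site (F.P K) (K - n), ‖Λ (K - n) y‖ ^ 2
      ≤ (F.L : ℝ) ^ (K - n) * (100 * N * (F.L : ℝ) ^ 4
            * (∑ x : Site (F.P K) 0, ∑ μ : Fin (F.P K).d, ∑ ν : Fin (F.P K).d,
                (if μ < ν then ∑ j : Fin N, ∑ k : Fin N,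
                  ‖(curl (torusT (F.P K) 0) (fun κ z => unitsField (toUField U₀) ⟨z, κ⟩) (fun κ z => Y ⟨z, κ⟩) μ ν x) j k‖ ^ 2 else 0)
              + ∑ x : Site (F.P K) 0, ∑ j : Fin N, ∑ k : Fin N,
                  ‖(divB (torusT (F.P K) 0) (fun κ z => unitsField (toUField U₀) ⟨z, κ⟩) (fun κ z => Y ⟨z, κ⟩) x) j k‖ ^ 2)
          + 10 ^ 9 * N ^ 2 * (F.L : ℝ) ^ 9 * ε * (((F.L : ℝ) ^ (K - n)) ^ 2)⁻¹ * ∑ b : PBond (F.P K) 0, ‖Y b‖ ^ 2) := by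
  have hd : (F.P K).d = 3 := T3ContinuumYM3Torus.T3Family.P_d F K
  have hLF : ((F.P K).L : ℝ) = (F.L : ℝ) := by norm_cast
  have hL3 : 3 ≤ (F.P K).L := by
    show 3 ≤ F.L
    obtain ⟨⟨m, hm⟩, h1⟩ := F.hL
    omega
  have hN : 1 ≤ N := Nat.one_le_iff_ne_zero.mpr (NeZero.ne N)
  have hk : K - n ≤ (F.P K).m + (F.P K).K := by show K - n ≤ F.m + K; omega
  rw [← hLF] at hεL hεN hU ⊢
  have hL3r : (3 : ℝ) ≤ (F.P K).L := by exact_mod_cast hL3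
  have hL1 : (1 : ℝ) ≤ (F.P K).L := by linarith
  have hN1 : (1 : ℝ) ≤ N := by exact_mod_cast hN
  have hL5 : (243 : ℝ) ≤ ((F.P K).L : ℝ) ^ 5 := by nlinarith [pow_le_pow_left₀ (by norm_num : (0 : ℝ) ≤ 3) hL3r 5]
  have hεs : 48600000 * ε ≤ 1 := by
    have := mul_le_mul_of_nonneg_right hL5 (by positivity : (0 : ℝ) ≤ 2 * 10 ^ 5 * ε)
    linarith
  -- the tower's smallness hypotheses at `2ε`
  have hε' : 0 < 2 * ε := by linarith
  have hε3 : (143 * (((((F.P K).d + 4 : ℕ) : ℝ)) ^ 2 / 4) ^ 2) * (2 * ε) ≤ 1 / 3 := by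
    rw [hd, show (143 * ((((3 + 4 : ℕ) : ℝ)) ^ 2 / 4) ^ 2) = 343343 / 16 by norm_num]
    linarith
  have hε2 : 2 * (2 * ε) ≤ 2 * deltaSU (Fin N) / ((((F.P K).d + 4) * (F.P K).L : ℕ) : ℝ) ^ 2 := by
    have hδ := one_div_le_deltaSU N
    rw [hd, le_div_iff₀ (by positivity)]
    push_cast
    have h1 : 98 * ((F.P K).L : ℝ) ^ 2 * ε ≤ 1 / (3 * N) := by
      rw [le_div_iff₀ (by positivity)]
      nlinarith [hεN]
    have e : 2 * (2 * ε) * (7 * ((F.P K).L : ℝ)) ^ 2 = 2 * (98 * ((F.P K).L : ℝ) ^ 2 * ε) := by ring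
    rw [e]
    linarith
  have hε24 : ((((F.P K).d + 2) * (F.P K).L : ℕ) : ℝ) ^ 2 / 4 * (2 * (2 * ε)) ≤ 1 / 24 := by
    rw [hd]; push_cast
    have hL3' : (1 : ℝ) ≤ ((F.P K).L : ℝ) ^ 3 := one_le_pow₀ hL1
    have h600 : 600 * ((F.P K).L : ℝ) ^ 2 * ε ≤ 2 * 10 ^ 5 * ((F.P K).L : ℝ) ^ 5 * ε := by
      have := mul_le_mul_of_nonneg_right (show (600 : ℝ) ≤ 2 * 10 ^ 5 * ((F.P K).L : ℝ) ^ 3 by linarith)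
        (by positivity : (0 : ℝ) ≤ ((F.P K).L : ℝ) ^ 2 * ε)
      linarith
    have e : (5 * ((F.P K).L : ℝ)) ^ 2 / 4 * (2 * (2 * ε)) = 25 * (((F.P K).L : ℝ) ^ 2 * ε) := by ring
    rw [e]
    linarith
  have hU' : PlaqSmall ((2 * ε) * ((((F.P K).L : ℝ) ^ (K - n))⁻¹) ^ 2) U₀ := by
    intro p
    have h := hU p
    have hpos : 0 < ε * ((((F.P K).L : ℝ) ^ (K - n)) ^ 2)⁻¹ := by positivity
    rw [inv_pow]
    linarith
  have hmain := sum_normSq_covIterLambda_le_T3 hd (K - n) hk U₀ hε' hε3 hε2 hε24 hU' Y G S Λ hΛ0 hG0 hS0 hΛs hGs hSs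
  refine hmain.trans ?_
  -- the gradient energy through curl, divergence and curvature
  have ha0 : 0 ≤ ε * ((((F.P K).L : ℝ) ^ (K - n)) ^ 2)⁻¹ := by positivity
  have hg := sum_normSq_covGrad_le_curl_divB U₀ ha0 hU Y
  have hS0' : 0 ≤ ∑ b : PBond (F.P K) 0, ∑ ν : Fin (F.P K).d,
      ‖((U₀ ⟨b.src, ν⟩ : Matrix.specialUnitaryGroup (Fin N) ℂ) : Matrix (Fin N) (Fin N) ℂ) * Y ⟨b.src.shift ν, b.dir⟩
          * star ((U₀ ⟨b.src, ν⟩ : Matrix.specialUnitaryGroup (Fin N) ℂ) : Matrix (Fin N) (Fin N) ℂ) - Y b‖ ^ 2 :=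
    Finset.sum_nonneg fun _ _ => Finset.sum_nonneg fun _ _ => sq_nonneg _
  rw [← Real.sq_sqrt hS0'] at hg
  have hY0 : 0 ≤ ∑ b : PBond (F.P K) 0, ‖Y b‖ ^ 2 := Finset.sum_nonneg fun _ _ => sq_nonneg _
  have hCD : 0 ≤ (∑ x : Site (F.P K) 0, ∑ μ : Fin (F.P K).d, ∑ ν : Fin (F.P K).d,
          (if μ < ν then ∑ j : Fin N, ∑ k : Fin N,
            ‖(curl (torusT (F.P K) 0) (fun κ z => unitsField (toUField U₀) ⟨z, κ⟩) (fun κ z => Y ⟨z, κ⟩) μ ν x) j k‖ ^ 2 else 0)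
        + ∑ x : Site (F.P K) 0, ∑ j : Fin N, ∑ k : Fin N,
            ‖(divB (torusT (F.P K) 0) (fun κ z => unitsField (toUField U₀) ⟨z, κ⟩) (fun κ z => Y ⟨z, κ⟩) x) j k‖ ^ 2) := by
    refine add_nonneg (Finset.sum_nonneg fun _ _ => Finset.sum_nonneg fun _ _ => Finset.sum_nonneg fun _ _ => ?_)
      (Finset.sum_nonneg fun _ _ => Finset.sum_nonneg fun _ _ => Finset.sum_nonneg fun _ _ => sq_nonneg _)
    split_ifs
    · exact Finset.sum_nonneg fun _ _ => Finset.sum_nonneg fun _ _ => sq_nonneg _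
    · exact le_rfl
  exact rows_rhs_le hd hL3 hN hε hεL (Real.sqrt_nonneg _) (Real.sq_sqrt hY0) hCD hg

/-- ★ **THE SAME AT `SU(2)` IN THE KNIT'S EXACT SHAPE** (`cΛ = 1`; the one numeral `10⁶·L⁵·ε ≤ 1` of ★routeR-w3's tower knit
`Prop7CurvedLandauKnitT3.sum_normSq_le_curl_sq_of_divBudget_of_tower_T3` suffices, `600L²ε ≤ 1` following from `L ≥ 3`): `Σ_y ‖Λ (K−n) y‖² ≤ 1·L^{K−n}·G₀` with
`G₀ = 100·2·L⁴·(CURL_HS + DIV_HS) + 10⁹·2²·L⁹·ε·(L^{2(K−n)})⁻¹·Σ_b‖Y b‖²` — the displayed `hΛ` hypothesis of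
`Prop7CurvedLandauCoercivity.sum_normSq_le_curl_sq_of_landau_of_structure_T3` for the recursion of record, by `exact`.
[cite: Balaban1985Variational, (135) p.298; Balaban1985BackgroundPropagators, Thm 3.11 p.416] -/
theorem sum_normSq_covIterLambda_le_curl_T3_su2 (F : T3ContinuumYM3Torus.T3Family) (n K : ℕ)
    (U₀ : GaugeField (F.P K) 0 (Matrix.specialUnitaryGroup (Fin 2) ℂ)) {ε : ℝ} (hε : 0 < ε)
    (hεL : 1000000 * (F.L : ℝ) ^ 5 * ε ≤ 1)
    (hU : ∀ p : Plaq (F.P K) 0, dist1 (GaugeField.plaqHol U₀ p) ≤ ε * (((F.L : ℝ) ^ (K - n)) ^ 2)⁻¹)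
    (Y : PBond (F.P K) 0 → Matrix (Fin 2) (Fin 2) ℂ)
    (G S : (j : ℕ) → PBond (F.P K) j → Matrix (Fin 2) (Fin 2) ℂ) (Λ : (j : ℕ) → Site (F.P K) j → Matrix (Fin 2) (Fin 2) ℂ)
    (hΛ0 : ∀ y, Λ 0 y = 0) (hG0 : ∀ b, G 0 b = Y b) (hS0 : ∀ b, S 0 b = Y b)
    (hΛs : ∀ (j : ℕ) (z : Site (F.P K) (j + 1)), Λ (j + 1) z
      = ((Fintype.card (Idx (F.P K)) : ℂ))⁻¹ • ∑ i : Idx (F.P K),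
          covWalkSum (Averaging.iter (fun i => blockAvg (P := F.P K) (j := i) (expMeanLogSU (n := Fin 2))) j U₀) (G j)
            (walk (emb z) (stairWord i.2.1 (off i.1)))
        + Λ j (emb z))
    (hGs : ∀ (k : ℕ) (c : PBond (F.P K) (k + 1)), G (k + 1) c
      = (fderiv ℂ (eml : (Idx (F.P K) → Matrix (Fin 2) (Fin 2) ℂ) → Matrix (Fin 2) (Fin 2) ℂ)
            (fun i => ((loopHol (Averaging.iter (fun i => blockAvg (P := F.P K) (j := i) (expMeanLogSU (n := Fin 2))) k U₀) c i :
              Matrix.specialUnitaryGroup (Fin 2) ℂ) : Matrix (Fin 2) (Fin 2) ℂ))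
            (fun i => covWalkSum (Averaging.iter (fun i => blockAvg (P := F.P K) (j := i) (expMeanLogSU (n := Fin 2))) k U₀) (G k)
                (walk (emb c.src) (loopWord (F.P K).L c.dir (off i.1) i.2.1 i.2.2))
              * ((loopHol (Averaging.iter (fun i => blockAvg (P := F.P K) (j := i) (expMeanLogSU (n := Fin 2))) k U₀) c i :
                Matrix.specialUnitaryGroup (Fin 2) ℂ) : Matrix (Fin 2) (Fin 2) ℂ))
            * star ((corr (expMeanLogSU (n := Fin 2)) (Averaging.iter (fun i => blockAvg (P := F.P K) (j := i) (expMeanLogSU (n := Fin 2))) k U₀) c :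
                Matrix.specialUnitaryGroup (Fin 2) ℂ) : Matrix (Fin 2) (Fin 2) ℂ)
          + ((corr (expMeanLogSU (n := Fin 2)) (Averaging.iter (fun i => blockAvg (P := F.P K) (j := i) (expMeanLogSU (n := Fin 2))) k U₀) c :
                Matrix.specialUnitaryGroup (Fin 2) ℂ) : Matrix (Fin 2) (Fin 2) ℂ)
            * covWalkSum (Averaging.iter (fun i => blockAvg (P := F.P K) (j := i) (expMeanLogSU (n := Fin 2))) k U₀) (G k)
                (walk (emb c.src) (List.replicate (F.P K).L (c.dir, true)))
            * star ((corr (expMeanLogSU (n := Fin 2)) (Averaging.iter (fun i => blockAvg (P := F.P K) (j := i) (expMeanLogSU (n := Fin 2))) k U₀) c :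
                Matrix.specialUnitaryGroup (Fin 2) ℂ) : Matrix (Fin 2) (Fin 2) ℂ))
        - ((((Fintype.card (Idx (F.P K)) : ℂ))⁻¹ • ∑ i : Idx (F.P K),
              covWalkSum (Averaging.iter (fun i => blockAvg (P := F.P K) (j := i) (expMeanLogSU (n := Fin 2))) k U₀) (G k) (walk (emb c.src) (stairWord i.2.1 (off i.1))))
            - ((Averaging.iter (fun i => blockAvg (P := F.P K) (j := i) (expMeanLogSU (n := Fin 2))) (k + 1) U₀ c : Matrix.specialUnitaryGroup (Fin 2) ℂ) :
                Matrix (Fin 2) (Fin 2) ℂ)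
              * (((Fintype.card (Idx (F.P K)) : ℂ))⁻¹ • ∑ i : Idx (F.P K),
                  covWalkSum (Averaging.iter (fun i => blockAvg (P := F.P K) (j := i) (expMeanLogSU (n := Fin 2))) k U₀) (G k) (walk (emb c.tgt) (stairWord i.2.1 (off i.1))))
              * star ((Averaging.iter (fun i => blockAvg (P := F.P K) (j := i) (expMeanLogSU (n := Fin 2))) (k + 1) U₀ c :
                Matrix.specialUnitaryGroup (Fin 2) ℂ) : Matrix (Fin 2) (Fin 2) ℂ)))
    (hSs : ∀ (k : ℕ) (c : PBond (F.P K) (k + 1)), S (k + 1) c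
      = ((Fintype.card (Idx (F.P K)) : ℂ))⁻¹ • ∑ i : Idx (F.P K),
          ((holAt (Averaging.iter (fun i => blockAvg (P := F.P K) (j := i) (expMeanLogSU (n := Fin 2))) k U₀) (walk (emb c.src) (stairWord i.2.1 (off i.1))) :
              Matrix.specialUnitaryGroup (Fin 2) ℂ) : Matrix (Fin 2) (Fin 2) ℂ) *
            covWalkSum (Averaging.iter (fun i => blockAvg (P := F.P K) (j := i) (expMeanLogSU (n := Fin 2))) k U₀) (S k)
              (walk (walkEnd (emb c.src) (stairWord i.2.1 (off i.1))) (List.replicate (F.P K).L (c.dir, true))) *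
          star ((holAt (Averaging.iter (fun i => blockAvg (P := F.P K) (j := i) (expMeanLogSU (n := Fin 2))) k U₀) (walk (emb c.src) (stairWord i.2.1 (off i.1))) :
              Matrix.specialUnitaryGroup (Fin 2) ℂ) : Matrix (Fin 2) (Fin 2) ℂ))
    :
    ∑ y : Site (F.P K) (K - n), ‖Λ (K - n) y‖ ^ 2
      ≤ 1 * (F.L : ℝ) ^ (K - n) * (100 * (2 : ℕ) * (F.L : ℝ) ^ 4
            * (∑ x : Site (F.P K) 0, ∑ μ : Fin (F.P K).d, ∑ ν : Fin (F.P K).d,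
                (if μ < ν then ∑ j : Fin 2, ∑ k : Fin 2,
                  ‖(curl (torusT (F.P K) 0) (fun κ z => unitsField (toUField U₀) ⟨z, κ⟩) (fun κ z => Y ⟨z, κ⟩) μ ν x) j k‖ ^ 2 else 0)
              + ∑ x : Site (F.P K) 0, ∑ j : Fin 2, ∑ k : Fin 2,
                  ‖(divB (torusT (F.P K) 0) (fun κ z => unitsField (toUField U₀) ⟨z, κ⟩) (fun κ z => Y ⟨z, κ⟩) x) j k‖ ^ 2)
          + 10 ^ 9 * (2 : ℕ) ^ 2 * (F.L : ℝ) ^ 9 * ε * (((F.L : ℝ) ^ (K - n)) ^ 2)⁻¹ * ∑ b : PBond (F.P K) 0, ‖Y b‖ ^ 2) := by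
  have hL3 : (3 : ℝ) ≤ F.L := by
    obtain ⟨⟨m, hm⟩, h1⟩ := F.hL
    exact_mod_cast (by omega : 3 ≤ F.L)
  have hεL' : 2 * 10 ^ 5 * (F.L : ℝ) ^ 5 * ε ≤ 1 := by
    have : (0 : ℝ) ≤ (F.L : ℝ) ^ 5 * ε := by positivity
    linarith
  have hεN : 300 * (2 : ℕ) * (F.L : ℝ) ^ 2 * ε ≤ 1 := by
    have hL3' : (27 : ℝ) ≤ (F.L : ℝ) ^ 3 := by nlinarith [pow_le_pow_left₀ (by norm_num : (0 : ℝ) ≤ 3) hL3 3]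
    have h := mul_le_mul_of_nonneg_right (show (600 : ℝ) ≤ 2 * 10 ^ 5 * (F.L : ℝ) ^ 3 by linarith)
      (by positivity : (0 : ℝ) ≤ (F.L : ℝ) ^ 2 * ε)
    push_cast
    linarith
  rw [one_mul]
  exact sum_normSq_covIterLambda_le_curl_T3 F n K U₀ hε hεL' hεN hU Y G S Λ hΛ0 hG0 hS0 hΛs hGs hSs

end Summit.QuantumFields.YangMills.Theorems.Prop7CovIterLambdaHLambdaCurl

end
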